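/-
Copyright (c) 2026 the pub-hodgecm-mathlib formalisation cell (harness21).  Prover seat hodgecm-mathlib-F0P2-p01 (g14), 2026-09-01.  ROAD «A6-IV» brick (b3) «THE CUBIC GENERATOR»,
FILE A: the jets of the cubic invariant `P₃ = Im tr(X³)` on `𝔲(2,1)` and of `p̄₃ = −Σθ_k³` on `𝔧`, and Harish-Chandra's 𝔤-side identity `8·∂(D³P₃) = ad(∂(ω))³(P₃·)`.
-/
import Literature.Geometry.ComplexHyperbolic.UnitBallLieAlgebraOrbitalSmooth        -- ★ (a1) p846487: `norm_apply_le_norm_matrix`; brings ★ (a0) `invP₃`, `invP₁`, `lieBasis`, `lieWeight`, `lieLaplacian`, `lieCubic`, `cubicForm`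
import Literature.Geometry.ComplexHyperbolic.UnitBallLieAlgebraCasimirInvariance    -- ★ (b0) p846473: `lieBasis_eq_literal`, `lieWeight_eq_literal`
import Literature.Analysis.Calculus.LaplacianPolynomialCommutator                   -- ★ (b2) FILE 2 (p09 (g2)): `weightedSecond_tripleCommutator_smul_iteratedFDeriv`, `iteratedFDeriv_three_apply_eq_nested`
import Mathlib.Analysis.Calculus.FDeriv.Mul
import Mathlib.Analysis.Calculus.FDeriv.Pow
import HarnessLib

/-!
# The jets of the cubic invariant `P₃ = Im tr(X³)` and Harish-Chandra's identity `8·∂(D³P₃) = ad(∂(ω))³(P₃·)` on `𝔲(2,1)` (ROAD «A6-IV» brick (b3), FILE A)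
# (Harish-Chandra 1957 «Differential operators on a semisimple Lie algebra»; Warner II §8.4.3)

Topic `Geometry/ComplexHyperbolic`; namespace `Literature.Geometry.ComplexHyperbolic.BallModel`.  THEOREMS ONLY (no `def`, no instance, no notation, no axiom, no named fact,
no `sorry`).  Cell `pub/hodgecm-mathlib`, ENGINE T1 (crux H413 = `stmt-HodgeConjecture-24833`); ROAD A, design of record `DESIGN-A6-InHouse-v2-ArchitectureIV` 93542b84 (LEAD T11-4),
SPEC `SPEC-A6IV-bricks` (b3); owner F0P3a-p05 (g15) word R-15.7 (1) «DEALT (b3) THE CUBIC GENERATOR»; author F0P2-p01 (g14), 2026-09-01.  FILE B (`UnitBallLieAlgebraHCCubic`) transports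
the identity of §3 through Harish-Chandra's `φ_f` to the 𝔧-side generator `φ_{∂(D³P₃)f} = 6·Σ_k ∂_k³ φ_f`; this file is measure-free calculus.

THE MATHEMATICS (all in the (a0) currency: `M₃(ℂ)` as a real normed space under `Matrix.Norms.Operator`, `E_a = lieBasis a`, `w_a = lieWeight a`, `L = lieLaplacian`,
`P₃ = invP₃`, `P₁ = invP₁`).
* §1 JETS OF `P₃`: `X ↦ Im tr X` is a bounded real-linear functional (`|Im tr X| ≤ 3‖X‖`), so `P₃ = Im tr ∘ (X ↦ X³)` is smooth and its directional derivatives are read off the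
  product rule (Mathlib `HasFDerivAt.mul'`) and trace cyclicity: `DP₃(X)[U] = 3·Im tr(X²U)`, `∂_V∂_U P₃(X) = 3·Im tr((VX+XV)U)`, `∂_W∂_V∂_U P₃ = 3·Im tr((VW+WV)U)`; in Mathlib's
  normal form `D²P₃(X)(U,V) = 3·Im tr((UX+XU)V)` and **`D³P₃(X)(U,V,W) = cubicForm U V W`** (= `3·Im tr(UVW + UWV)`, the (a0) polarisation).
* §2 THE CASIMIR MATRIX `Σ_a w_a E_a² = 3·1` (81 literal entries) ⇒ **`∂(ω)P₃ = Σ_a w_a D²P₃(X)(E_a,E_a) = 6·Im tr(X·Σ_a w_aE_a²) = 18·P₁(X)`** — LINEAR, so ★ (b2)'s affine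
  hypothesis `hLP` holds with `ℓ = 18·Im tr`, `c = 0`.
* §3 THE 𝔤-SIDE IDENTITY: ★ (b2) `weightedSecond_tripleCommutator_smul_iteratedFDeriv` at `U = univ`, `L := lieLaplacian` (given everywhere by the `iteratedFDeriv` formula — `rfl`),
  `P := P₃`, with §1–§2: for every smooth `f` and every `X`, **`L³(P₃f)(X) − 3·L²(P₃·Lf)(X) + 3·L(P₃·L²f)(X) − P₃(X)·L³f(X) = 8·lieCubic f X`** (`lieCubic` IS `∂(D³P₃)` by §1 and
  `lieCubic_def`).
* §4 JETS OF `p̄₃(θ) = −(θ₀³+θ₁³+θ₂³)` on `ℝ³` (= `P₃ ∘ torusH`, ★ (a0) `invP₃_torusH`): `Dp̄₃(θ)[v] = −3Σθ_k²v_k`, `∂_u∂_v p̄₃ = −6Σθ_ku_kv_k`, `∂_{u′}∂_u∂_v p̄₃ = −6Σu′_ku_kv_k`; hence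
  **`(−Δ_θ)p̄₃ = Σ_k(−1)·D²p̄₃(θ)(e_k,e_k) = 6(θ₀+θ₁+θ₂)`** (linear: ★ (b2)'s `hLP` on the 𝔧 side with `w ≡ −1`) and the collapse of ★ (b2)'s right-hand side on 𝔧:
  **`Σ_{abc}((−1)³·D³p̄₃(θ)(e_a,e_b,e_c)) • T a b c = 6 • Σ_k T k k k`** for any coefficients `T` (`D³p̄₃(e_a,e_b,e_c) = −6·[a=b=c]`).
ENGINEERING NOTE for the next hand in this currency: under `open scoped Matrix.Norms.Operator` an EXPLICITLY TYPED `M₃(ℂ) →L[ℝ] _` elaborates with the product topology while the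
derivative CLMs produced by `HasFDerivAt` carry the operator-norm topology (equal, but not at `instances` transparency), so `rw`∕`simp` refuse to touch such mixed terms; the proofs
below therefore never name a derivative CLM: they evaluate `(fderiv …) U` through `congrArg (· U) h.fderiv` and a `show` of the definitional unfolding, and they reach `Im tr` through
`IsBoundedLinearMap` (whose `toContinuousLinearMap` lives in the normed world).
HONEST LABEL: HC_CM is proved only modulo the printed citations until rung 0 closes; finite-dimensional calculus, pays nothing by itself.

## References
* [HarishChandra1957DiffOps] Harish-Chandra, *Differential operators on a semisimple Lie algebra*, Amer. J. Math. 79 (1957) 87–120, Part I §§2–3 (`∂(p)` for invariant `p`; the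
  `∂(ω)`-commutators) — not held; cited for the device.
* [WarnerHASSLG2] G. Warner, *Harmonic Analysis on Semi-Simple Lie Groups II*, Grundlehren 189 (1972), §8.4.3 (the invariants `P₁, P₂, P₃` and `∂(D³P₃)` on `𝔲(2,1)`).
* [Dieudonne1960] J. Dieudonné, *Foundations of Modern Analysis* (1960), Ch. VIII §12 (higher derivatives of polynomial maps).
-/

set_option autoImplicit false

noncomputable section

namespace Literature.Geometry.ComplexHyperbolic

namespace BallModel

open _root_.Complex _root_.Matrix _root_.Set _root_.Filter _root_.Topology
open Literature.Analysis.Calculus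
open scoped Matrix.Norms.Operator ComplexConjugate ContDiff RightActions

/-! ## §1 The jets of `P₃ = Im tr(X³)` -/

section CubicInvariant

/-- `X ↦ Im tr X` is a bounded real-linear functional on `(M₃(ℂ), ‖·‖_{∞-op})`: `|Im tr X| ≤ 3‖X‖`. [cite: WarnerHASSLG2, §8.4.3] -/
theorem isBoundedLinearMap_im_trace : IsBoundedLinearMap ℝ fun X : Matrix (Fin 3) (Fin 3) ℂ => (Matrix.trace X).im := by
  refine IsLinearMap.with_bound ⟨fun X Y => ?_, fun c X => ?_⟩ 3 fun X => ?_
  · simp only [Matrix.trace_add, Complex.add_im]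
  · simp only [Matrix.trace_smul, Complex.real_smul, Complex.mul_im, Complex.ofReal_re, Complex.ofReal_im, zero_mul, add_zero,
      smul_eq_mul]
  · rw [Real.norm_eq_abs]
    calc |(Matrix.trace X).im| ≤ ‖Matrix.trace X‖ := Complex.abs_im_le_norm _
      _ = ‖∑ i : Fin 3, X i i‖ := by rw [Matrix.trace]; rfl
      _ ≤ ∑ i : Fin 3, ‖X i i‖ := norm_sum_le _ _
      _ ≤ ∑ _i : Fin 3, ‖X‖ := Finset.sum_le_sum fun i _ => norm_apply_le_norm_matrix X i i
      _ = 3 * ‖X‖ := by simp [Finset.sum_const, Finset.card_univ, Fintype.card_fin]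

/-- The derivative of `Y ↦ Y³` at `X` (product rule, Mathlib `HasFDerivAt.mul'`): `U ↦ X²U + (XU + UX)X`, as the CLM the product rule produces. [cite: Dieudonne1960, Ch. VIII §12] -/
theorem hasFDerivAt_cube (X : Matrix (Fin 3) (Fin 3) ℂ) :
    HasFDerivAt (fun Y : Matrix (Fin 3) (Fin 3) ℂ => Y * Y * Y)
      ((X * X) • ContinuousLinearMap.id ℝ (Matrix (Fin 3) (Fin 3) ℂ) +
        (X • ContinuousLinearMap.id ℝ (Matrix (Fin 3) (Fin 3) ℂ) + ContinuousLinearMap.id ℝ (Matrix (Fin 3) (Fin 3) ℂ) <• X) <• X) X := by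
  have h1 : HasFDerivAt (fun Y : Matrix (Fin 3) (Fin 3) ℂ => Y) (ContinuousLinearMap.id ℝ (Matrix (Fin 3) (Fin 3) ℂ)) X := hasFDerivAt_id X
  exact (h1.mul' h1).mul' h1

/-- `P₃` is smooth (a cubic polynomial map composed with a bounded linear functional). [cite: WarnerHASSLG2, §8.4.3] -/
theorem contDiff_invP₃ : ContDiff ℝ ∞ invP₃ :=
  isBoundedLinearMap_im_trace.contDiff.comp ((contDiff_id.mul contDiff_id).mul contDiff_id)

/-- **`DP₃(X)[U] = 3·Im tr(X²U)`** (product rule + `tr(XUX) = tr(UX²) = tr(X²U)`). [cite: WarnerHASSLG2, §8.4.3] [cite: Dieudonne1960, Ch. VIII §12] -/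
theorem fderiv_invP₃_apply (X U : Matrix (Fin 3) (Fin 3) ℂ) :
    fderiv ℝ invP₃ X U = 3 * (Matrix.trace (X * X * U)).im := by
  have hT := isBoundedLinearMap_im_trace
  have hd := hT.hasFDerivAt.comp X (hasFDerivAt_cube X)
  have e := congrArg (fun φ => φ U) hd.fderiv
  refine e.trans ?_
  show (Matrix.trace (X * X * U + (X * U + U * X) * X)).im = _
  rw [Matrix.add_mul, Matrix.trace_add, Matrix.trace_add, Complex.add_im, Complex.add_im,
    Matrix.trace_mul_cycle X U X, Matrix.trace_mul_cycle U X X, Matrix.trace_mul_cycle X U X]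
  ring

/-- **`∂_V∂_U P₃(X) = 3·Im tr((VX + XV)U)`**. [cite: WarnerHASSLG2, §8.4.3] [cite: Dieudonne1960, Ch. VIII §12] -/
theorem fderiv_fderiv_invP₃_apply (X U V : Matrix (Fin 3) (Fin 3) ℂ) :
    fderiv ℝ (fun Y => fderiv ℝ invP₃ Y U) X V = 3 * (Matrix.trace ((V * X + X * V) * U)).im := by
  have hT := isBoundedLinearMap_im_trace
  have h : (fun Y => fderiv ℝ invP₃ Y U) =
      fun Y => (3 : ℝ) • ((fun Z : Matrix (Fin 3) (Fin 3) ℂ => (Matrix.trace Z).im) ∘ fun Y : Matrix (Fin 3) (Fin 3) ℂ => Y * Y * U) Y := by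
    funext Y; rw [fderiv_invP₃_apply, Function.comp_apply, smul_eq_mul]
  have h1 : HasFDerivAt (fun Y : Matrix (Fin 3) (Fin 3) ℂ => Y) (ContinuousLinearMap.id ℝ (Matrix (Fin 3) (Fin 3) ℂ)) X := hasFDerivAt_id X
  have hsq := (h1.mul' h1).mul' (hasFDerivAt_const U X)
  have hd := (hT.hasFDerivAt.comp X hsq).const_smul (3 : ℝ)
  rw [h]
  have e := congrArg (fun φ => φ V) hd.fderiv
  refine e.trans ?_
  show 3 * (Matrix.trace (X * X * 0 + (X * V + V * X) * U)).im = _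
  rw [Matrix.mul_zero, zero_add, add_comm (X * V)]

/-- **`∂_W∂_V∂_U P₃ = 3·Im tr((VW + WV)U)`** (constant in `X`). [cite: WarnerHASSLG2, §8.4.3] [cite: Dieudonne1960, Ch. VIII §12] -/
theorem fderiv_fderiv_fderiv_invP₃_apply (X U V W : Matrix (Fin 3) (Fin 3) ℂ) :
    fderiv ℝ (fun Z => fderiv ℝ (fun Y => fderiv ℝ invP₃ Y U) Z V) X W = 3 * (Matrix.trace ((V * W + W * V) * U)).im := by
  have hT := isBoundedLinearMap_im_trace
  have h : (fun Z => fderiv ℝ (fun Y => fderiv ℝ invP₃ Y U) Z V) =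
      fun Z => (3 : ℝ) • ((fun Z : Matrix (Fin 3) (Fin 3) ℂ => (Matrix.trace Z).im) ∘ fun Y : Matrix (Fin 3) (Fin 3) ℂ => (V * Y + Y * V) * U) Z := by
    funext Z; rw [fderiv_fderiv_invP₃_apply, Function.comp_apply, smul_eq_mul]
  have h1 : HasFDerivAt (fun Y : Matrix (Fin 3) (Fin 3) ℂ => Y) (ContinuousLinearMap.id ℝ (Matrix (Fin 3) (Fin 3) ℂ)) X := hasFDerivAt_id X
  have hlin := (((hasFDerivAt_const V X).mul' h1).add (h1.mul' (hasFDerivAt_const V X))).mul' (hasFDerivAt_const U X)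
  have hd := (hT.hasFDerivAt.comp X hlin).const_smul (3 : ℝ)
  rw [h]
  have e := congrArg (fun φ => φ W) hd.fderiv
  refine e.trans ?_
  show 3 * (Matrix.trace ((V * X + X * V) * 0 + ((V * W + 0 * X) + (X * 0 + W * V)) * U)).im = _
  rw [Matrix.mul_zero, zero_add, Matrix.zero_mul, add_zero, Matrix.mul_zero, zero_add]

/-- **`D²P₃(X)(U, V) = 3·Im tr((UX + XU)V)`** in Mathlib's `iteratedFDeriv` normal form (★ (b2) FILE 1 `iteratedFDeriv_two_apply_eq_fderiv_fderiv_apply`). [cite: WarnerHASSLG2, §8.4.3] -/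
theorem iteratedFDeriv_two_invP₃ (X U V : Matrix (Fin 3) (Fin 3) ℂ) :
    iteratedFDeriv ℝ 2 invP₃ X ![U, V] = 3 * (Matrix.trace ((U * X + X * U) * V)).im := by
  rw [iteratedFDeriv_two_apply_eq_fderiv_fderiv_apply (contDiff_invP₃.contDiffAt.of_le (by norm_cast))]
  exact fderiv_fderiv_invP₃_apply X V U

/-- **`D³P₃(X)(U, V, W) = cubicForm U V W`** — the (a0) polarised cubic IS the third derivative of `P₃` (★ (b2) FILE 2 `iteratedFDeriv_three_apply_eq_nested` + trace cyclicity).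
[cite: WarnerHASSLG2, §8.4.3] -/
theorem iteratedFDeriv_three_invP₃ (X U V W : Matrix (Fin 3) (Fin 3) ℂ) :
    iteratedFDeriv ℝ 3 invP₃ X ![U, V, W] = cubicForm U V W := by
  rw [iteratedFDeriv_three_apply_eq_nested isOpen_univ contDiff_invP₃.contDiffOn (mem_univ X)]
  refine (fderiv_fderiv_fderiv_invP₃_apply X W V U).trans ?_
  rw [cubicForm, Matrix.add_mul, Matrix.trace_add, Matrix.trace_add, Matrix.trace_mul_cycle V U W, Matrix.trace_mul_cycle W V U]
  ring

end CubicInvariant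

/-! ## §2 The Casimir matrix and `∂(ω)P₃ = 18·P₁` -/

section Casimir

/-- **THE CASIMIR MATRIX `Σ_a w_a E_a² = 3·1`** (torus `Σ E_kk = 1`, each root plane `E_ii + E_jj`; 81 literal entries). [cite: WarnerHASSLG2, §8.4.3] -/
theorem sum_lieWeight_smul_lieBasis_mul_lieBasis :
    ∑ a : Fin 9, ((lieWeight a : ℝ) : ℂ) • (lieBasis a * lieBasis a) = (3 : ℂ) • (1 : Matrix (Fin 3) (Fin 3) ℂ) := by
  rw [lieBasis_eq_literal, lieWeight_eq_literal]
  ext i j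
  fin_cases i <;> fin_cases j <;> simp [Fin.sum_univ_succ] <;> norm_num

/-- **`∂(ω)P₃ = 18·P₁`**: `Σ_a w_a • D²P₃(X)(E_a, E_a) = 6·Im tr(X·Σ_a w_aE_a²) = 18·Im tr X` — the Casimir image of the cubic invariant is LINEAR (★ (b2)'s affine hypothesis `hLP`).
[cite: HarishChandra1957DiffOps, Part I §3] [cite: WarnerHASSLG2, §8.4.3] -/
theorem sum_lieWeight_smul_iteratedFDeriv_two_invP₃ (X : Matrix (Fin 3) (Fin 3) ℂ) :
    ∑ a : Fin 9, lieWeight a • iteratedFDeriv ℝ 2 invP₃ X ![lieBasis a, lieBasis a] = 18 * invP₁ X := by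
  have hterm : ∀ a : Fin 9, lieWeight a • iteratedFDeriv ℝ 2 invP₃ X ![lieBasis a, lieBasis a] =
      6 * (((lieWeight a : ℝ) : ℂ) * Matrix.trace (X * (lieBasis a * lieBasis a))).im := by
    intro a
    rw [iteratedFDeriv_two_invP₃, Matrix.add_mul, Matrix.trace_add, Matrix.trace_mul_cycle (lieBasis a) X (lieBasis a),
      Matrix.trace_mul_cycle (lieBasis a) (lieBasis a) X, Matrix.mul_assoc,
      Complex.add_im, Complex.im_ofReal_mul, smul_eq_mul]
    ring
  calc ∑ a : Fin 9, lieWeight a • iteratedFDeriv ℝ 2 invP₃ X ![lieBasis a, lieBasis a]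
      = ∑ a : Fin 9, 6 * (((lieWeight a : ℝ) : ℂ) * Matrix.trace (X * (lieBasis a * lieBasis a))).im := Finset.sum_congr rfl fun a _ => hterm a
    _ = 6 * (∑ a : Fin 9, ((lieWeight a : ℝ) : ℂ) * Matrix.trace (X * (lieBasis a * lieBasis a))).im := by rw [Complex.im_sum, Finset.mul_sum]
    _ = 6 * (Matrix.trace (X * ∑ a : Fin 9, ((lieWeight a : ℝ) : ℂ) • (lieBasis a * lieBasis a))).im := by
        rw [Finset.mul_sum, Matrix.trace_sum]
        congr 2
        refine Finset.sum_congr rfl fun a _ => ?_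
        rw [Matrix.mul_smul, Matrix.trace_smul, smul_eq_mul]
    _ = 18 * invP₁ X := by
        rw [sum_lieWeight_smul_lieBasis_mul_lieBasis, Matrix.mul_smul, Matrix.mul_one, Matrix.trace_smul, smul_eq_mul, invP₁,
          show (3 : ℂ) = ((3 : ℝ) : ℂ) by norm_cast, Complex.im_ofReal_mul]
        ring

end Casimir

/-! ## §3 Harish-Chandra's 𝔤-side identity `ad(∂(ω))³(P₃·) = 8·∂(D³P₃)` -/

section GSide

/-- **THE 𝔤-SIDE IDENTITY `ad(∂(ω))³(P₃·)f = 8·∂(D³P₃)f`**: for every smooth `f : M₃(ℂ) → E` and every `X`,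
`L³(P₃f)(X) − 3·L²(P₃·Lf)(X) + 3·L(P₃·L²f)(X) − P₃(X)·L³f(X) = 8·lieCubic f X` (`L = lieLaplacian`) — ★ (b2) `weightedSecond_tripleCommutator_smul_iteratedFDeriv` at `U = univ` with
`hL := rfl`, `P := P₃` (`hLP` = §2 with `ℓ = 18·Im tr`, `c = 0`) and `D³P₃ = cubicForm` (§1), `lieCubic_def`. [cite: HarishChandra1957DiffOps, Part I §3] [cite: WarnerHASSLG2, §8.4.3] -/
theorem lieLaplacian_tripleCommutator_invP₃ {E : Type*} [NormedAddCommGroup E] [NormedSpace ℝ E] {f : Matrix (Fin 3) (Fin 3) ℂ → E} (hf : ContDiff ℝ ∞ f)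
    (X : Matrix (Fin 3) (Fin 3) ℂ) :
    lieLaplacian (lieLaplacian (lieLaplacian (fun Y => invP₃ Y • f Y))) X - (3 : ℝ) • lieLaplacian (lieLaplacian (fun Y => invP₃ Y • lieLaplacian f Y)) X +
        (3 : ℝ) • lieLaplacian (fun Y => invP₃ Y • lieLaplacian (lieLaplacian f) Y) X - invP₃ X • lieLaplacian (lieLaplacian (lieLaplacian f)) X =
      (8 : ℝ) • lieCubic f X := by
  have hℓ := isBoundedLinearMap_im_trace
  have key := weightedSecond_tripleCommutator_smul_iteratedFDeriv (V := Matrix (Fin 3) (Fin 3) ℂ) (F := E) (E := lieBasis) (w := lieWeight) (U := univ)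
    isOpen_univ lieLaplacian (fun χ y => rfl) contDiff_invP₃ ((18 : ℝ) • hℓ.toContinuousLinearMap) 0
    (fun y => by rw [sum_lieWeight_smul_iteratedFDeriv_two_invP₃, add_zero]; rfl) hf.contDiffOn (mem_univ X)
  rw [key, lieCubic_def]
  simp only [iteratedFDeriv_three_invP₃]

end GSide

/-! ## §4 The jets of `p̄₃(θ) = −(θ₀³+θ₁³+θ₂³)` on `ℝ³` (the 𝔧-side inputs of ★ (b2)) -/

section Torus

/-- `p̄₃(θ) = −(θ₀³+θ₁³+θ₂³)` (= `P₃(torusH θ)`, ★ (a0) `invP₃_torusH`) is smooth. [cite: WarnerHASSLG2, §8.4.3] -/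
theorem contDiff_negCubeSum : ContDiff ℝ ∞ fun θ : Fin 3 → ℝ => -(θ 0 ^ 3 + θ 1 ^ 3 + θ 2 ^ 3) :=
  (((contDiff_apply ℝ ℝ 0).pow 3).add ((contDiff_apply ℝ ℝ 1).pow 3) |>.add ((contDiff_apply ℝ ℝ 2).pow 3)).neg

/-- `Dp̄₃(θ)[v] = −3Σ_k θ_k²v_k`. [cite: Dieudonne1960, Ch. VIII §12] -/
theorem fderiv_negCubeSum_apply (θ v : Fin 3 → ℝ) :
    fderiv ℝ (fun θ : Fin 3 → ℝ => -(θ 0 ^ 3 + θ 1 ^ 3 + θ 2 ^ 3)) θ v = -(3 * θ 0 ^ 2 * v 0 + 3 * θ 1 ^ 2 * v 1 + 3 * θ 2 ^ 2 * v 2) := by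
  have e0 : HasFDerivAt (fun θ : Fin 3 → ℝ => θ 0) (ContinuousLinearMap.proj (R := ℝ) (φ := fun _ : Fin 3 => ℝ) 0) θ := hasFDerivAt_apply 0 θ
  have e1 : HasFDerivAt (fun θ : Fin 3 → ℝ => θ 1) (ContinuousLinearMap.proj (R := ℝ) (φ := fun _ : Fin 3 => ℝ) 1) θ := hasFDerivAt_apply 1 θ
  have e2 : HasFDerivAt (fun θ : Fin 3 → ℝ => θ 2) (ContinuousLinearMap.proj (R := ℝ) (φ := fun _ : Fin 3 => ℝ) 2) θ := hasFDerivAt_apply 2 θ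
  have h := (((e0.pow 3).add (e1.pow 3)).add (e2.pow 3)).neg
  rw [show fderiv ℝ (fun θ : Fin 3 → ℝ => -(θ 0 ^ 3 + θ 1 ^ 3 + θ 2 ^ 3)) θ = _ from h.fderiv]
  simp only [_root_.neg_apply, _root_.add_apply, _root_.smul_apply, ContinuousLinearMap.proj_apply, smul_eq_mul, nsmul_eq_mul,
    Nat.cast_ofNat]

/-- … as a function of `θ`. [cite: Dieudonne1960, Ch. VIII §12] -/
theorem fderiv_negCubeSum_apply_eq_fun (v : Fin 3 → ℝ) :
    (fun θ : Fin 3 → ℝ => fderiv ℝ (fun θ : Fin 3 → ℝ => -(θ 0 ^ 3 + θ 1 ^ 3 + θ 2 ^ 3)) θ v) =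
      fun θ => -(3 * θ 0 ^ 2 * v 0 + 3 * θ 1 ^ 2 * v 1 + 3 * θ 2 ^ 2 * v 2) :=
  funext fun θ => fderiv_negCubeSum_apply θ v

/-- `∂_u∂_v p̄₃(θ) = −6Σ_k θ_ku_kv_k`. [cite: Dieudonne1960, Ch. VIII §12] -/
theorem fderiv_fderiv_negCubeSum_apply (θ u v : Fin 3 → ℝ) :
    fderiv ℝ (fun θ : Fin 3 → ℝ => fderiv ℝ (fun θ : Fin 3 → ℝ => -(θ 0 ^ 3 + θ 1 ^ 3 + θ 2 ^ 3)) θ v) θ u =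
      -(6 * θ 0 * u 0 * v 0 + 6 * θ 1 * u 1 * v 1 + 6 * θ 2 * u 2 * v 2) := by
  rw [fderiv_negCubeSum_apply_eq_fun]
  have e0 : HasFDerivAt (fun θ : Fin 3 → ℝ => θ 0) (ContinuousLinearMap.proj (R := ℝ) (φ := fun _ : Fin 3 => ℝ) 0) θ := hasFDerivAt_apply 0 θ
  have e1 : HasFDerivAt (fun θ : Fin 3 → ℝ => θ 1) (ContinuousLinearMap.proj (R := ℝ) (φ := fun _ : Fin 3 => ℝ) 1) θ := hasFDerivAt_apply 1 θ
  have e2 : HasFDerivAt (fun θ : Fin 3 → ℝ => θ 2) (ContinuousLinearMap.proj (R := ℝ) (φ := fun _ : Fin 3 => ℝ) 2) θ := hasFDerivAt_apply 2 θ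
  have h := (((((e0.pow 2).const_mul 3).mul_const (v 0)).add (((e1.pow 2).const_mul 3).mul_const (v 1))).add
    (((e2.pow 2).const_mul 3).mul_const (v 2))).neg
  rw [show fderiv ℝ (fun θ : Fin 3 → ℝ => -(3 * θ 0 ^ 2 * v 0 + 3 * θ 1 ^ 2 * v 1 + 3 * θ 2 ^ 2 * v 2)) θ = _ from h.fderiv]
  simp only [_root_.neg_apply, _root_.add_apply, _root_.smul_apply, ContinuousLinearMap.proj_apply, smul_eq_mul, nsmul_eq_mul,
    Nat.cast_ofNat]
  ring_nf

/-- … as a function of `θ`. [cite: Dieudonne1960, Ch. VIII §12] -/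
theorem fderiv_fderiv_negCubeSum_apply_eq_fun (u v : Fin 3 → ℝ) :
    (fun θ : Fin 3 → ℝ => fderiv ℝ (fun θ : Fin 3 → ℝ => fderiv ℝ (fun θ : Fin 3 → ℝ => -(θ 0 ^ 3 + θ 1 ^ 3 + θ 2 ^ 3)) θ v) θ u) =
      fun θ => -(6 * θ 0 * u 0 * v 0 + 6 * θ 1 * u 1 * v 1 + 6 * θ 2 * u 2 * v 2) :=
  funext fun θ => fderiv_fderiv_negCubeSum_apply θ u v

/-- `∂_{u′}∂_u∂_v p̄₃ = −6Σ_k u′_ku_kv_k` (constant in `θ`). [cite: Dieudonne1960, Ch. VIII §12] -/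
theorem fderiv_fderiv_fderiv_negCubeSum_apply (θ u' u v : Fin 3 → ℝ) :
    fderiv ℝ (fun θ : Fin 3 → ℝ => fderiv ℝ (fun θ : Fin 3 → ℝ => fderiv ℝ (fun θ : Fin 3 → ℝ => -(θ 0 ^ 3 + θ 1 ^ 3 + θ 2 ^ 3)) θ v) θ u) θ u' =
      -(6 * u' 0 * u 0 * v 0 + 6 * u' 1 * u 1 * v 1 + 6 * u' 2 * u 2 * v 2) := by
  rw [fderiv_fderiv_negCubeSum_apply_eq_fun]
  have e0 : HasFDerivAt (fun θ : Fin 3 → ℝ => θ 0) (ContinuousLinearMap.proj (R := ℝ) (φ := fun _ : Fin 3 => ℝ) 0) θ := hasFDerivAt_apply 0 θ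
  have e1 : HasFDerivAt (fun θ : Fin 3 → ℝ => θ 1) (ContinuousLinearMap.proj (R := ℝ) (φ := fun _ : Fin 3 => ℝ) 1) θ := hasFDerivAt_apply 1 θ
  have e2 : HasFDerivAt (fun θ : Fin 3 → ℝ => θ 2) (ContinuousLinearMap.proj (R := ℝ) (φ := fun _ : Fin 3 => ℝ) 2) θ := hasFDerivAt_apply 2 θ
  have h := (((((e0.const_mul 6).mul_const (u 0)).mul_const (v 0)).add (((e1.const_mul 6).mul_const (u 1)).mul_const (v 1))).add
    (((e2.const_mul 6).mul_const (u 2)).mul_const (v 2))).neg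
  rw [show fderiv ℝ (fun θ : Fin 3 → ℝ => -(6 * θ 0 * u 0 * v 0 + 6 * θ 1 * u 1 * v 1 + 6 * θ 2 * u 2 * v 2)) θ = _ from h.fderiv]
  simp only [_root_.neg_apply, _root_.add_apply, _root_.smul_apply, ContinuousLinearMap.proj_apply, smul_eq_mul]
  ring

/-- **`(−Δ_θ)p̄₃ = 6(θ₀+θ₁+θ₂)`**: `Σ_k (−1)·D²p̄₃(θ)(e_k,e_k) = 6Σθ_k` — LINEAR, ★ (b2)'s `hLP` on the 𝔧 side (`w ≡ −1`, `E_k = e_k`). [cite: HarishChandra1957DiffOps, Part I §3] -/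
theorem sum_neg_iteratedFDeriv_two_negCubeSum (θ : Fin 3 → ℝ) :
    ∑ k : Fin 3, (-1 : ℝ) • iteratedFDeriv ℝ 2 (fun θ : Fin 3 → ℝ => -(θ 0 ^ 3 + θ 1 ^ 3 + θ 2 ^ 3)) θ ![Pi.single k 1, Pi.single k 1] =
      6 * (θ 0 + θ 1 + θ 2) := by
  have h2 : ∀ k : Fin 3, iteratedFDeriv ℝ 2 (fun θ : Fin 3 → ℝ => -(θ 0 ^ 3 + θ 1 ^ 3 + θ 2 ^ 3)) θ ![Pi.single k 1, Pi.single k 1] =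
      -(6 * θ 0 * (Pi.single k 1 : Fin 3 → ℝ) 0 * (Pi.single k 1 : Fin 3 → ℝ) 0 + 6 * θ 1 * (Pi.single k 1 : Fin 3 → ℝ) 1 * (Pi.single k 1 : Fin 3 → ℝ) 1 +
        6 * θ 2 * (Pi.single k 1 : Fin 3 → ℝ) 2 * (Pi.single k 1 : Fin 3 → ℝ) 2) := fun k => by
    rw [iteratedFDeriv_two_apply_eq_fderiv_fderiv_apply (contDiff_negCubeSum.contDiffAt.of_le (by norm_cast)), fderiv_fderiv_negCubeSum_apply]
  simp only [h2, Fin.sum_univ_three, Pi.single_apply]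
  simp only [Fin.isValue, ↓reduceIte, one_ne_zero, Fin.reduceEq, mul_one, mul_zero, add_zero, zero_add, smul_eq_mul]
  ring_nf

/-- **THE 𝔧-SIDE RIGHT-HAND SIDE OF ★ (b2) COLLAPSES TO THE DIAGONAL**: `D³p̄₃(θ)(e_a,e_b,e_c) = −6·[a = b = c]`, so for any coefficients `T`,
`Σ_{a,b,c} ((−1)·(−1)·(−1)·D³p̄₃(θ)(e_a,e_b,e_c)) • T a b c = 6 • Σ_k T k k k`. [cite: HarishChandra1957DiffOps, Part I §3] -/
theorem sum_sum_sum_iteratedFDeriv_three_negCubeSum_smul {E : Type*} [AddCommGroup E] [Module ℝ E] (θ : Fin 3 → ℝ) (T : Fin 3 → Fin 3 → Fin 3 → E) :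
    ∑ a : Fin 3, ∑ b : Fin 3, ∑ c : Fin 3,
        ((-1 : ℝ) * (-1) * (-1) * iteratedFDeriv ℝ 3 (fun θ : Fin 3 → ℝ => -(θ 0 ^ 3 + θ 1 ^ 3 + θ 2 ^ 3)) θ ![Pi.single a 1, Pi.single b 1, Pi.single c 1]) • T a b c =
      (6 : ℝ) • ∑ k : Fin 3, T k k k := by
  have h3 : ∀ a b c : Fin 3, iteratedFDeriv ℝ 3 (fun θ : Fin 3 → ℝ => -(θ 0 ^ 3 + θ 1 ^ 3 + θ 2 ^ 3)) θ ![Pi.single a 1, Pi.single b 1, Pi.single c 1] =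
      -(6 * (Pi.single a 1 : Fin 3 → ℝ) 0 * (Pi.single b 1 : Fin 3 → ℝ) 0 * (Pi.single c 1 : Fin 3 → ℝ) 0 +
        6 * (Pi.single a 1 : Fin 3 → ℝ) 1 * (Pi.single b 1 : Fin 3 → ℝ) 1 * (Pi.single c 1 : Fin 3 → ℝ) 1 +
        6 * (Pi.single a 1 : Fin 3 → ℝ) 2 * (Pi.single b 1 : Fin 3 → ℝ) 2 * (Pi.single c 1 : Fin 3 → ℝ) 2) := fun a b c => by
    rw [iteratedFDeriv_three_apply_eq_nested isOpen_univ contDiff_negCubeSum.contDiffOn (mem_univ θ), fderiv_fderiv_fderiv_negCubeSum_apply]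
  simp only [h3, Fin.sum_univ_three, Pi.single_apply]
  simp [smul_add]

end Torus

end BallModel

end Literature.Geometry.ComplexHyperbolic

end
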